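import Mathlib
import HarnessLib
import Summits.HubbardSuperconductivity.HubbardSuperconductivity.Theorems.KLProgrammeKLRegimeTwoVolumeTowerStepCovZeroTwoFrame
import Summits.HubbardSuperconductivity.HubbardSuperconductivity.Theorems.KLProgrammeKLRegimeTwoVolumeTowerStepCovFlowData
import Summits.HubbardSuperconductivity.HubbardSuperconductivity.Theorems.KLProgrammeKLRegimeTwoVolumeSliceFrameDefect
import Summits.HubbardSuperconductivity.HubbardSuperconductivity.Theorems.KLProgrammeKLRegimeEngineSymbolThresholds
import Summits.HubbardSuperconductivity.HubbardSuperconductivity.Theorems.KLProgrammeKLRegimeEngineThresholdBridges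
import Summits.HubbardSuperconductivity.HubbardSuperconductivity.Theorems.KLProgrammeKLRegimeAlphaWtFlowDeep
import Summits.HubbardSuperconductivity.HubbardSuperconductivity.Theorems.KLProgrammeKLRegimeVolumeLimitV11HinstDoors
import Summits.HubbardSuperconductivity.HubbardSuperconductivity.Theorems.KLProgrammeKLRegimeTwoVolumeTowerDefs

/-!
# Route `KLProgramme` — crux K3, VL child (stmt-HubbardSuperconductivity-20440): THE STEP-COVARIANCE FRAME MISMATCH OF THE TWO VOLUMES AT THE FIRST STEP
# (`j = 0`: entries, rows and columns) IS A THEOREM UNDER THE TOWER — the block «HmisZero» of the atom `HmisCov`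
# (seat p3 g19; suppliers: p3's `…TwoVolumeTowerStepCovZeroTwoFrame` (entries `norm_klStepCov_zero_sub_apply_le_unif`, plain rows/columns
# `rowCol_klStepCov_zero_sub_le_of_jets`), k3c4-p2 g11's two-volume increment data `incrementData_twoVolume_of_towerV17F2'`, p3 g16's
# `norm_iteratedFDeriv_three_frameLevel_klFlowFrameU_le`; packaging after k3c4-p1 g17's `hmisCovRowsPos_of_towerP` for `1 ≤ j < n_β`)

`klStepCov V M β μ K 0 = S(𝟙)ᵀ·C^K_{(Λ₂,Λ₁]}·S(𝟙)` at EVERY frame (p3 g17), so for the two flow frames `K_L`, `K_{bL}` (top index `n_β+1`) the mismatch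
`klStepCov (bL) M β μ K_{bL} 0 − klStepCov (bL) M β μ K_L 0` is the constant-multiplier pull-back of the symbol increment; its four increment jets are
`≤ cst/L` (the tower), the base frame's third jet is `≤ 64 + Gfr₃U²·4^{n_β+1}/3 ≤ 65·x` with `x := 4^{n_β+1}`, so in the two-scale class
`(G₀, x) = (cst·x²/L, 4^{n_β+1})` (`L ≥ cst·x²`): entries `≤ 𝒞ₑ·cst/L` (uniform in `b`, `M`), rows and columns `≤ Cr·(M/β)·cst·x/L = (Cr·cst·x/(2L))/ε_M`.

* **`hmisCovZero_of_towerP`** — for every `(G, P, Q, R)` with `R.WF2` (doors: any `c ≤ 1`, `U ≤ min 1 (1/(Gfr₃+1))`): under `TowerP klPredsV17F2 …`,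
  `∃ sE cR cC : ℕ → ℝ` (`0 ≤ ·`, caps `cR, cC ≤ 1`, all three `→ 0`), `∃ L₂ M₂`, at every instance `L₂ ≤ L`, `M₂ L b ≤ M`: entries `≤ sE L`, rows
  `≤ cR L/ε_M`, columns `≤ cC L/ε_M` of `klStepCov (bL) M β μ K_{bL} 0 − klStepCov (bL) M β μ K_L 0` — the three `j = 0` conjuncts of `HmisCov`
  (`…VolumeLimitV11TowerDataWOfGridMCov`), rates depending on `L` only.

Proofs only; no definition; nothing asserts HmisCov, any stub, K3, VL or superconductivity.  [cite: BenfattoGiulianiMastropietro2006, §2.8 (2.80)–(2.81), §3 (3.2)–(3.3)]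
-/

noncomputable section

namespace Summit.HubbardSuperconductivity.HubbardSuperconductivity.Theorems.TwoVolumeSource

set_option linter.dupNamespace false -- summit = problem name (single-conjunct summit), D-0017

open Finset Filter Topology Literature.MathematicalPhysics.QuantumLattice GrassmannAlgebra Literature.Probability.LatticeModels
  Literature.Probability.LatticeModels.BattleFederbush Literature.MathematicalPhysics.QuantumLattice.BandSectorCounting
open Summit.HubbardSuperconductivity.HubbardSuperconductivity.Theorems.TwoPointAssembly
open Summit.HubbardSuperconductivity.HubbardSuperconductivity.Theorems.KLRegimeSplit
open Summit.HubbardSuperconductivity.HubbardSuperconductivity.Theorems.KLProgrammeLegKernels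
open Summit.HubbardSuperconductivity.HubbardSuperconductivity.Theorems.EngineV8
open Summit.HubbardSuperconductivity.HubbardSuperconductivity.Theorems.TwoVolumeDefect
open Summit.HubbardSuperconductivity.HubbardSuperconductivity.Theorems.TorusFourierL2
open Summit.HubbardSuperconductivity.HubbardSuperconductivity.Theorems.PerturbedFermiCurve
open Summit.HubbardSuperconductivity.HubbardSuperconductivity.Theorems.DispersionFlow
open scoped Real

set_option maxHeartbeats 1600000 in -- long regime bookkeeping (thresholds, four jets, two currencies)
/-- **THE STEP-COVARIANCE FRAME MISMATCH AT THE FIRST STEP (ENTRIES / ROWS / COLUMNS, `j = 0`) IS A THEOREM UNDER THE TOWER** (see the module docstring).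
[cite: BenfattoGiulianiMastropietro2006, §2.8 (2.80)–(2.81), §3 (3.2)–(3.3)] -/
theorem hmisCovZero_of_towerP (G : GeoConsts) (P : SplitConsts) (Q : EngConsts) (R : RenConsts) (hR2 : R.WF2) :
    ∃ c₇ : ℝ, 0 < c₇ ∧ ∀ c : ℝ, 0 < c → c ≤ c₇ → ∃ U₇ : ℝ, 0 < U₇ ∧
      ∀ μ ∈ klWindowC, ∀ U : ℝ, 0 < U → U ≤ U₇ → ∀ β : ℝ, klBetaMin ≤ β → β ≤ Real.exp (c / U ^ 2) →
        ∀ (K : TrigPolyC4v) (Lstar : ℕ) (Mstar : ℕ → ℕ), TowerP klPredsV17F2 G P Q R β U μ K Lstar Mstar →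
        ∃ (sE cR cC : ℕ → ℝ), (∀ L, 0 ≤ sE L ∧ 0 ≤ cR L ∧ 0 ≤ cC L ∧ cR L ≤ 1 ∧ cC L ≤ 1) ∧
          (Tendsto sE atTop (𝓝 0) ∧ Tendsto cR atTop (𝓝 0) ∧ Tendsto cC atTop (𝓝 0)) ∧
        ∃ L₂ : ℕ, ∃ M₂ : ℕ → ℕ → ℕ, ∀ (L b M : ℕ) [NeZero L] [NeZero (b * L)] [NeZero M], L₂ ≤ L → M₂ L b ≤ M →
          (∀ x y, ‖(klStepCov (b * L) M β μ (klFlowFrameU (b * L) M β U μ (nScales β + 1)) 0 -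
              klStepCov (b * L) M β μ (klFlowFrameU L M β U μ (nScales β + 1)) 0) x y‖ ≤ sE L) ∧
          (∀ x, ∑ y, ‖(klStepCov (b * L) M β μ (klFlowFrameU (b * L) M β U μ (nScales β + 1)) 0 -
              klStepCov (b * L) M β μ (klFlowFrameU L M β U μ (nScales β + 1)) 0) x y‖ ≤ cR L / imagTimeWeight β M) ∧
          (∀ y, ∑ x, ‖(klStepCov (b * L) M β μ (klFlowFrameU (b * L) M β U μ (nScales β + 1)) 0 -
              klStepCov (b * L) M β μ (klFlowFrameU L M β U μ (nScales β + 1)) 0) x y‖ ≤ cC L / imagTimeWeight β M) := by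
  classical
  -- the absolute row/column constant of part 1 at third-jet slope `65`
  obtain ⟨Cr, hCr, hrow⟩ := rowCol_klStepCov_zero_sub_le_of_jets 65 (by norm_num)
  have hRj : ∀ j, 0 ≤ R.Gfr j := gfr_nonneg_of_wf2 hR2
  refine ⟨1, one_pos, fun c hc _ => ⟨min 1 (1 / (R.Gfr 3 + 1)), lt_min one_pos (by have := hRj 3; positivity),
    fun μ hμ U hU hUle β hβmin hβc K Lstar Mstar hT => ?_⟩⟩
  have hβ0 : 0 < β := KLRegimeSplit.pos_of_klBetaMin_le hβmin
  have hβ1 : 1 ≤ β := le_trans (by norm_num [klBetaMin]) hβmin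
  have hU1 : U ≤ 1 := hUle.trans (min_le_left _ _)
  have hUG : U ≤ 1 / (R.Gfr 3 + 1) := hUle.trans (min_le_right _ _)
  have hGU2 : R.Gfr 3 * U ^ 2 ≤ 1 := by
    have h3 := hRj 3
    have hGU : R.Gfr 3 * U ≤ 1 := by
      calc R.Gfr 3 * U ≤ R.Gfr 3 * (1 / (R.Gfr 3 + 1)) := mul_le_mul_of_nonneg_left hUG h3
        _ = R.Gfr 3 / (R.Gfr 3 + 1) := by ring
        _ ≤ 1 := by rw [div_le_one (by positivity)]; linarith
    calc R.Gfr 3 * U ^ 2 = R.Gfr 3 * U * U := by ring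
      _ ≤ 1 * 1 := mul_le_mul hGU hU1 hU.le zero_le_one
      _ = 1 := one_mul 1
  have hn1 : 1 ≤ nScales β + 1 := Nat.le_add_left 1 _
  -- the tower's increment numerators (orders `0 … 3`) and one majorant `cst ≥ 1`
  set Ac : ℕ → ℝ := fun r => ∑ m ∈ range (nScales β + 1), 4 * (2 * klFlowDeg m + 1) * (1 + 4 * klFlowDeg m) ^ r * Q.CL β m with hAc
  set cst : ℝ := |Ac 0| + |Ac 1| + |Ac 2| + |Ac 3| + 1 with hcst
  have hcst1 : 1 ≤ cst := by
    have := abs_nonneg (Ac 0); have := abs_nonneg (Ac 1); have := abs_nonneg (Ac 2); have := abs_nonneg (Ac 3); linarith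
  have hcst0 : 0 < cst := lt_of_lt_of_le one_pos hcst1
  have hAj : ∀ j ≤ 3, Ac j ≤ cst := by
    intro j hj
    have h0 := le_abs_self (Ac 0); have h1 := le_abs_self (Ac 1); have h2 := le_abs_self (Ac 2); have h3 := le_abs_self (Ac 3)
    have a0 := abs_nonneg (Ac 0); have a1 := abs_nonneg (Ac 1); have a2 := abs_nonneg (Ac 2); have a3 := abs_nonneg (Ac 3)
    interval_cases j <;> simp only [hcst] <;> linarith
  -- the scale `x = 4^{n_β+1}`, the entry constant, the rates
  set x : ℝ := (4 : ℝ) ^ (nScales β + 1) with hx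
  have hx1 : 1 ≤ x := one_le_pow₀ (by norm_num)
  have hx0 : 0 < x := lt_of_lt_of_le one_pos hx1
  set Ce : ℝ := 2 * (klScale klE0 1 / π + 3) * (1793 * klScale klE0 1 + 704) * ((16 * (32 / 3) + 16) / klScale klE0 2 ^ 2) with hCe
  have hΛ1 : 0 < klScale klE0 1 := klth_klScale_pos 1
  have hΛ2 : 0 < klScale klE0 2 := klth_klScale_pos 2
  have hCe0 : 0 ≤ Ce := by rw [hCe]; positivity
  set sRate : ℕ → ℝ := fun L => Ce * cst / L with hsRate
  set cRate : ℕ → ℝ := fun L => Cr * cst * x / 2 / L with hcRate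
  have hsRate0 : ∀ L, 0 ≤ sRate L := fun L => by simp only [hsRate]; positivity
  have hcRate0 : ∀ L, 0 ≤ cRate L := fun L => by simp only [hcRate]; positivity
  -- the caps' threshold
  set Lcap : ℕ := ⌈cst * x ^ 2⌉₊ + ⌈Cr * cst * x / 2⌉₊ + 1 with hLcap
  refine ⟨sRate, fun L => min 1 (cRate L), fun L => min 1 (cRate L), fun L => ⟨hsRate0 L, le_min zero_le_one (hcRate0 L),
    le_min zero_le_one (hcRate0 L), min_le_left _ _, min_le_left _ _⟩, ?_,
    max (max Lstar (klEngL₃ β U)) Lcap,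
    fun L b => max (max (Mstar L) (Mstar (b * L))) (max (klEngM₃ β U (b * L)) (max (Q.M0 β L) (Q.M0 β (b * L)))),
    fun L b M _ _ _ hL hM => ?_⟩
  · -- the three limits
    have hs : Tendsto sRate atTop (𝓝 0) := by
      have h := tendsto_const_div_atTop_nhds_zero_nat (Ce * cst)
      exact h.congr fun L => by simp only [hsRate]
    have hc' : Tendsto (fun L : ℕ => min 1 (cRate L)) atTop (𝓝 0) := by
      have h := tendsto_const_div_atTop_nhds_zero_nat (Cr * cst * x / 2)
      refine squeeze_zero (fun L => le_min zero_le_one (hcRate0 L)) (fun L => (min_le_right _ _).trans (le_of_eq ?_)) h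
      simp only [hcRate]
    exact ⟨hs, hc', hc'⟩
  -- one instance
  dsimp only at hL hM
  have hLs : Lstar ≤ L := by omega
  have hL3 : klEngL₃ β U ≤ L := by omega
  have hLc : Lcap ≤ L := by omega
  have hMs : Mstar L ≤ M := by omega
  have hMsb : Mstar (b * L) ≤ M := by omega
  have hM3b : klEngM₃ β U (b * L) ≤ M := by omega
  have hMQ : Q.M0 β L ≤ M := by omega
  have hMQb : Q.M0 β (b * L) ≤ M := by omega
  have hb1 : 1 ≤ b := Nat.pos_of_ne_zero fun hb => NeZero.ne (b * L) (by rw [hb, Nat.zero_mul])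
  have hLbL : L ≤ b * L := Nat.le_mul_of_pos_left L hb1
  have hL3b : klEngL₃ β U ≤ b * L := hL3.trans hLbL
  have hL0 : (0 : ℝ) < L := Nat.cast_pos.2 (Nat.pos_of_ne_zero (NeZero.ne L))
  have hM0 : (0 : ℝ) < M := Nat.cast_pos.2 (Nat.pos_of_ne_zero (NeZero.ne M))
  have hLcapR : (Lcap : ℝ) ≤ L := by exact_mod_cast hLc
  have hLcap1 : cst * x ^ 2 ≤ L := by
    have h1 : cst * x ^ 2 ≤ ⌈cst * x ^ 2⌉₊ := Nat.le_ceil _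
    have h2 : ((⌈cst * x ^ 2⌉₊ : ℕ) : ℝ) ≤ Lcap := by
      simp only [hLcap]; push_cast; linarith [Nat.cast_nonneg (α := ℝ) ⌈Cr * cst * x / 2⌉₊]
    linarith
  have hLcap2 : Cr * cst * x / 2 ≤ L := by
    have h1 : Cr * cst * x / 2 ≤ ⌈Cr * cst * x / 2⌉₊ := Nat.le_ceil _
    have h2 : ((⌈Cr * cst * x / 2⌉₊ : ℕ) : ℝ) ≤ Lcap := by
      simp only [hLcap]; push_cast; linarith [Nat.cast_nonneg (α := ℝ) ⌈cst * x ^ 2⌉₊]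
    linarith
  -- the flow frames of the two volumes and the base frame's third jet
  have hhL := histP_top_of_towerP hT hLs hMs
  have hhb := histP_top_of_towerP hT (hLs.trans hLbL) hMsb
  have hK : FrameOK R U (nScales β) μ (klFlowFrameU L M β U μ (nScales β + 1)) := frameOK_klFlowFrameU_of_histP_le hR2 hn1 le_rfl le_rfl hhL
  have hKb : FrameOK R U (nScales β) μ (klFlowFrameU (b * L) M β U μ (nScales β + 1)) :=
    frameOK_klFlowFrameU_of_histP_le hR2 hn1 le_rfl le_rfl hhb
  have hJL : ∀ m' < nScales β + 1, FlowPieceJetsAt L M β U μ R m' := fun m' hm' =>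
    ((histP_klPredsV17F2_iff L M G P Q R β U μ 0 (nScales β + 1)).1 hhL m' hm').2.1.2.1
  have hE3 : ∀ p : Momentum, ‖iteratedFDeriv ℝ 3 (frameLevel μ (klFlowFrameU L M β U μ (nScales β + 1))) p‖ ≤ 65 * x := fun p => by
    have h := norm_iteratedFDeriv_three_frameLevel_klFlowFrameU_le (L := L) (M := M) (μ := μ) hRj hJL p
    have h1 : R.Gfr 3 * U ^ 2 * (x / 3) ≤ 1 * (x / 3) := mul_le_mul_of_nonneg_right hGU2 (by positivity)
    have h2 : (64 : ℝ) ≤ 64 * x := by nlinarith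
    calc _ ≤ 64 + R.Gfr 3 * U ^ 2 * (x / 3) := h
      _ ≤ 65 * x := by linarith
  -- the increment jets of the two frames (second frame the fine one)
  obtain ⟨hΔ0, hΔ1, hΔ2, hΔ3⟩ := incrementData_twoVolume_of_towerV17F2' hμ hT hLs hLbL hMs hMQ hMsb hMQb (n := nScales β + 1) le_rfl
  -- the lattice threshold `β ≤ M` on the fine lattice
  have hMβ : β ≤ (M : ℝ) := le_of_klEngM₃_le hβmin hL3b hM3b
  -- the amplitude `G₀ = cst·x²/L ∈ [0, 1]`
  set G₀ : ℝ := cst * x ^ 2 / L with hG₀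
  have hG0 : 0 ≤ G₀ := by simp only [hG₀]; positivity
  have hG1 : G₀ ≤ 1 := by simp only [hG₀]; rw [div_le_one hL0]; exact hLcap1
  have eG2 : G₀ / x ^ 2 = cst / L := by simp only [hG₀]; field_simp
  have eG1 : cst * x / L = G₀ / x := by simp only [hG₀]; field_simp
  have hcL : cst / L ≤ cst * x / L := div_le_div_of_nonneg_right (le_mul_of_one_le_right hcst0.le hx1) hL0.le
  have hcL2 : cst / L ≤ G₀ := by
    simp only [hG₀]
    refine div_le_div_of_nonneg_right ?_ hL0.le
    have : (1 : ℝ) ≤ x ^ 2 := one_le_pow₀ hx1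
    exact le_mul_of_one_le_right hcst0.le this
  have hcL3 : cst / L ≤ G₀ * x := hcL2.trans (le_mul_of_one_le_right hG0 hx1)
  have hj0 : ∀ p : Momentum, |frameLevel μ (klFlowFrameU (b * L) M β U μ (nScales β + 1)) p - frameLevel μ (klFlowFrameU L M β U μ (nScales β + 1)) p| ≤
      G₀ / x ^ 2 := fun p => (hΔ0 p).trans (by rw [eG2]; exact div_le_div_of_nonneg_right (hAj 0 (by norm_num)) hL0.le)
  have hP₀ : ∀ p : Momentum, |frameLevel μ (klFlowFrameU (b * L) M β U μ (nScales β + 1)) p - frameLevel μ (klFlowFrameU L M β U μ (nScales β + 1)) p| ≤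
      cst / L := fun p => (hΔ0 p).trans (div_le_div_of_nonneg_right (hAj 0 (by norm_num)) hL0.le)
  have hj1 : ∀ p : Momentum, ‖fderiv ℝ (fun q : Momentum => frameLevel μ (klFlowFrameU (b * L) M β U μ (nScales β + 1)) q -
      frameLevel μ (klFlowFrameU L M β U μ (nScales β + 1)) q) p‖ ≤ G₀ / x := fun p =>
    (hΔ1 p).trans ((div_le_div_of_nonneg_right (hAj 1 (by norm_num)) hL0.le).trans (by rw [← eG1]; exact hcL))
  have hj2 : ∀ p : Momentum, ‖iteratedFDeriv ℝ 2 (fun q : Momentum => frameLevel μ (klFlowFrameU (b * L) M β U μ (nScales β + 1)) q -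
      frameLevel μ (klFlowFrameU L M β U μ (nScales β + 1)) q) p‖ ≤ G₀ := fun p =>
    (hΔ2 p).trans ((div_le_div_of_nonneg_right (hAj 2 (by norm_num)) hL0.le).trans hcL2)
  have hj3 : ∀ p : Momentum, ‖iteratedFDeriv ℝ 3 (fun q : Momentum => frameLevel μ (klFlowFrameU (b * L) M β U μ (nScales β + 1)) q -
      frameLevel μ (klFlowFrameU L M β U μ (nScales β + 1)) q) p‖ ≤ G₀ * x := fun p =>
    (hΔ3 p).trans ((div_le_div_of_nonneg_right (hAj 3 (by norm_num)) hL0.le).trans hcL3)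
  -- part 1: rows / columns in the two-scale class, entries volume-free
  obtain ⟨hr, hc'⟩ := hrow (b * L) M R U (nScales β) R U (nScales β) μ _ _ hK hKb G₀ x hG0 hG1 hx1 hE3 hj0 hj1 hj2 hj3 β hβmin hMβ
  have hent := fun X Y => norm_klStepCov_zero_sub_apply_le_unif (V := b * L) (M := M) hK hKb hβ1 (P₀ := cst / L) (by positivity) hP₀ X Y
  -- the bound in the `ε_M` currency and the cap
  have hid : Cr * ((M : ℝ) / β) * (G₀ / x) = cRate L / imagTimeWeight β M := by
    rw [← eG1]
    simp only [hcRate, imagTimeWeight]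
    field_simp
  have hcap : cRate L ≤ 1 := by
    simp only [hcRate]
    rw [div_le_one hL0]
    exact hLcap2
  refine ⟨fun X Y => (hent X Y).trans (le_of_eq (by simp only [hsRate, hCe]; ring)), fun X => ?_, fun Y => ?_⟩
  · show _ ≤ min 1 (cRate L) / imagTimeWeight β M
    rw [min_eq_right hcap, ← hid]
    exact hr X
  · show _ ≤ min 1 (cRate L) / imagTimeWeight β M
    rw [min_eq_right hcap, ← hid]
    exact hc' Y

end Summit.HubbardSuperconductivity.HubbardSuperconductivity.Theorems.TwoVolumeSource

end
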